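import Literature.MathematicalPhysics.QuantumFieldTheory.Balaban1983to89.B6HolderPairMemberV1
import Literature.MathematicalPhysics.QuantumFieldTheory.Balaban1983to89.B6CubeRightLegsV1
import Literature.MathematicalPhysics.QuantumFieldTheory.Balaban1983to89.B6Prop25HolderGDivTwoScaleV1

/-!
# `Balaban1983to89.B6CubePairOutDecayV1` — T. Bałaban, *Propagators and renormalization transformations for lattice gauge theories. II*,
# Commun. Math. Phys. **96** (1984) 223–250 [Balaban1984PropagatorsII], Prop. 2.6 (2.137) p. 247 (second member `‖ζG∇*J‖_α`) with (2.133),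
# (2.141) p. 247 and Prop. 2.5 p. 246 / [4] (1.110)–(1.111) p. 35: THE PAIR (HÖLDER-IN-THE-OUTPUT) MAJORANTS OF THE CUBE'S `G_□` AND OF ITS
# RIGHT LEGS `G_□·E_e` ON THE GLOBAL V1 TORUS, OUTPUT-LOCALISED OVER `□⁺`, INPUTS ANYWHERE — the members ([4] (1.111)₂ `G∇*`, ours; (1.110)₂
# telescoped, p22's) carried through r03's OUTPUT band bridge `outDecay_window_V1`

statement-level skeleton of published theorems with citation tags; proofs where landed; nothing here is a claim about the Yang–Mills mass gap

PDF held: `paper:balaban1984-cmp96-propagators-rt-ii` (journal page = PDF page + 222), p. 247 [PDF 25] (×2 render re-read this generation):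
*"‖ζ∇GJ‖_α, ‖ζG∇*J‖_α ≤ O(1)(Lʲη)^{1−α}(‖ζ‖^ξ_α + |ζ|)e^{−δ₃d(y,y′)}|J|, ξ = L^{−j} (2.137)"*; *"|(G_□J)(x)|, |(∇G_□J)(x)| ≤ O(1)[(Lʲη)², Lʲη]
e^{−δ₂(Lʲη)^{−1}dist(Δ,Δ′)}|J| (2.133)"*; *"G = … = Σ_ω h_{□₀}G_{□₀}h_{□₀}K_{□₁,□₂}… (2.141) and the series above is convergent in the norms appearing in
the inequalities (2.136)–(2.140)"*; p. 246 [PDF 24]: *"Proposition 2.5. The operator G_□ defined by (2.90) … satisfies all the inequalities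
(1.110)–(1.114) of the Proposition 1.2 with a positive constant δ₂ instead of δ₀"*; [4] = *… I*, CMP **95** (1984) (1.111) p. 35: *"‖ζ∇GJ‖_α,
‖ζG∇*J‖_α ≤ O(1)e^{−δ₀|y−y′|}(‖ζ‖_α + |ζ|)|J|"*, (1.109) p. 35 (the Hölder quotient).

CITATION HEADER (lean-in-tree rule) — WHAT IS REPRODUCED.  Phase-2 file of the `lit-balaban` typed skeleton (HOME `run/shared/lean/pub/lit-balaban/`),
seat **p38 gen 32** (free target (2.137)₂ `‖ζG∇*J‖_α` at k levels for the genuine `G`, protocol G.5-34(d), TAKING HOME/STATUS.md 2026-08-23T22:54Z, no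
objection); SKELETON rows **B6.Prop2.6** × B6.Eq2.133 × B6.Prop2.5 (cells only; decls of record untouched).  THE READING (ours, see `…B6Prop26PairMirrorAssemblyV1`):
the second member of (2.137) is a TWO-SIDED entry — the pair-difference operator `P_{x,x′} = pairOp x x′` (p22's `…B6HolderPairMemberV1`) on the LEFT of
`G`, the adjoint derivative `∇*_ν` on the RIGHT; one step of the transposed walk `P·G·∇* = P·G₀·∇* + (P·R̃)·(G·∇*)` needs, per cube, GLOBAL majorants
(inputs anywhere) of `P·h_□G_□` and of its `2(d+1)` right legs `P·h_□G_□·E_e` — hence OUTPUT-localised pair majorants of `G_□`, `G_□·E_e` (this file),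
not the input-localised ones of p22's companion `…B6CubeHolderInDecayV1` (first legs of (2.137)₁).  Contents:
* §1 THE MEMBERS ON `T_□` (shape of p22's `holder2137_member`): **`holderGDadj_member`** — [4] (1.111)₂ `‖ζG∇*J‖_α` for the genuine two-scale `G_□`
  (p38's `…B6Prop25HolderGDivTwoScaleV1.holderBound_GDadj_scaling`, BY NAME): there is `δ₂ > 0` and for every `0 ≤ α < 1` a `C_α ≥ 0` with
  `HasMajorant (tsGeo i R M) (y(·₋)) (P_{b₁,b₂}·onFun(G_□∘∇_λ*)) (C_α·t^α·e^{−δ₂|y−y′|_T})` for bonds `b₁, b₂` of the same direction,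
  `t = |b₁₋ − b₂₋|_∞/Lʲ ≤ 1`; **`holderGDl_member`** — the same for `G_□∘∇_λ` (input shift by one fine bond, the pair twin of p22's
  `…B6CubeRightLegsV1.blockBound_GDl_scaling`: constant `C_α(1 + e^{δ₂})`); **`holderGE_member`** — both with ONE `(δ; α ↦ C_α)`;
* §2 THE OPERATOR IDENTITY **`pairOp_translate_mul_Gl_mul_EC_eq`** — `P_{c₁+v,c₂+v}·(G_□·E_e) = τ_{−v}·(s(□)⁻¹•ε(P_{ec₁,ec₂}·(G_t∘∇_e))ρ)·τ_v` for
  window bonds `c₁, c₂` (p22's `Gl_mul_EC_eq` + p22's transport calculus `TB_neg_mul_pairOp_mul_TB` / `transplant_pairOp_mul`);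
* §3 ON THE GLOBAL TORUS, OUTPUT-LOCALISED OVER `□⁺ = Q^T_□`, INPUTS ANYWHERE (r03's `outDecay_window_V1`, the script of p22's `hGout_cube`):
  **`hGEout_cube`** — the single-point right legs `G_□·E_e` (`OutMajorant … (ST □) (C_G·(L^{j(y)}/c′)²·e^{−δ_G d_T})`, the Out twin of p22's
  `hGEin_cube`); **`hHGout_cube`** — the pair majorant of `G_□`: for window bonds `c₁, c₂` of the same direction with charted initial points at
  sup-distance `≤ L^{j_t}` on `T_□`, `OutMajorant (geomT D) (blkV1 hN D) (P_{c₁+v,c₂+v}·G_□) (ST □) (C_H·t·(L^{j(y)}/c′)²·e^{−δ_H d_T})`;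
  **`hHGEout_cube`** — the pair majorants of all `2(d+1)` right legs `G_□·E_e`: for every `0 ≤ α < 1` a `C_H`,
  `OutMajorant … (P_{c₁+v,c₂+v}·(G_□·E_e)) (ST □) (C_H·t^α·(L^{j(y)}/c′)²·e^{−δ_H d_T})`.
IMPORTS BY NAME, restating nothing (p22's `pairOp_translate_mul_Gl_eq` of the not-yet-landed `…B6CubeHolderInDecayV1` is inlined PRIVATELY, §2);
THEOREMS ONLY (no `def`, no `def … : Prop`, no new hypothesis); standard axioms.

HONEST SCOPE / DIVERGENCES.  (1) Print proves (2.137) by *"reasoning as in the proof of Proposition 2.2"*; the output-localised reading of the cube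
legs behind a pair-difference operator is OUR bookkeeping for the two-sided walk (HOME/GAPS.md G-B6-2137-2), no mathematical gap in the source is claimed.
(2) As p22's `hGout_cube`: `L ≥ 5` (band `C = 9`), `M_h ≥ 2`, `R ≥ 2L²`, placed cube; rate `δ/(9(d+1))`, constants ours; the prefactor `(L^{j(y)}/c′)²`
is that of `G_□` (the unit `s(□)` sits in the consumer's coefficients).  (3) The pair is given in the CHART FRAME of the cube (`c₁, c₂` window bonds, global
bonds `c₁ + v`, `c₂ + v`), `t` measured on `T_□`; the passage global pair ↦ chart pair for admissible pairs, the product rule with `h_□` and the assembled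
legs of `P·h_□G_□` are the next files (p22's placement file; this seat's `…B6HolderDivLegPairTermsV1`).  Integer tori, lattice units; nothing on d = 4
specifically or the continuum; NOT summit progress.  Unit `lit-balaban-p38` (gen 32), 2026-08-24.
-/

noncomputable section

open scoped BigOperators
open Finset

namespace Literature.MathematicalPhysics.QuantumFieldTheory.Balaban1983to89.B6CubePairOutDecayV1

open LatticeFieldCalculus
open B5Eq118OneStroke (iterBlockOf)
open B5Eq117TorusCarriers (Mk)
open BalabanImbrieJaffe1984to88.BIJ85AxialPropagator411 (BondSpace)
open B4Reflection242 (boxDom)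
open B4TorusKernel.MultiPeriod (torusSupNorm)
open B6LowerBound2153Torus (rep)
open B6BlockDecayCalculus (torusDist_isPseudoDist)
open B6BlockDecayHprimeCovV1 (torusDist_blk_unshift_le_one)
open B10StarCount (shift_unshift unshift_shift)
open B6MultiLevelBoxOperator (N0)
open B6MultiLevelTorusOperator (TDomains)
open B6Eq238MultiLevelTorus (svec)
open B6Cover236MultiLevelBlocks (cubes)
open B6Geom246MultiLevelBox (bset)
open B6Partition118KLevelTorusCentral (one_le_of_four_le)
open B6GlobalChartV1 (PV toBox blkV1 domT)
open B6AgreeLapV1Chart (cB eB posV mem_cB_W)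
open B6Prop25TwoScaleCensus (TSIdx)
open B6Prop26KLevelSkeletonV1 (ST pref pref_nonneg)
open B6Geom246MultiLevelTorus (geomT blkMap)
open B6SectAOperatorsV1 (BondIdx)
open B6Ineq2133TwoScaleV1 (onFun onFun_apply tsGeo)
open B6RandomWalk (HasMajorant hasMajorant_mono BlockSupp)
open B6InDecayWindowV1 (OutMajorant outMajorant_mono outMajorant_congr_set outMajorant_smul_of_le_on outDecay_window_V1)
open B6Prop26ReachTransplant (transplant)
open B6TranslateTorusV1 (vch TB kernel_blkMap)
open B6Eq292MemberTorusV1 (EC)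
open B6CubeWindowV1 (x0 j0 tC sc hx0 hfit Placed wC Gl SQ mem_SQ mem_blkMap_image_SQ)
open B6CubeInDecayV1 (outMajorant_conj_chart conj_mul Gl_eq hdiv_cube hlev_full hband_cube sc_inv_le_pref transplant_off sc_nonneg smul_kernel_le)
open B6CubeRightLegsV1 (Gl_mul_EC_eq Dl_single_eq iterBlockOf_shift_or ineq2133_legs_right)
open B6HolderPairMemberV1 (pairOp hasMajorant_pairOp_of_holderBound_classical holderG_member transplant_pairOp_mul TB_neg_mul_pairOp_mul_TB)
open B6Prop25HolderGDivTwoScaleV1 (holderBound_GDadj_scaling)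

/-! ## §1  The members on `T_□`: the pair majorants of `G_□∘∇_λ*` ([4] (1.111)₂) and `G_□∘∇_λ` (input shift) -/

section Member

variable {d L : ℕ} {hd : 1 ≤ d + 1} {hL : Odd L ∧ 1 < L} {a₀ a₁ : ℝ}

open Classical in
/-- **[4] (1.111)₂, MEMBER `‖ζG∇*J‖_α`, FOR THE GENUINE TWO-SCALE `G_□` OF (2.90) AS A PAIR MAJORANT ON `T_□`** (p38's `holderBound_GDadj_scaling`, BY
NAME; Prop. 2.5's *"(1.111) with δ₂ instead of δ₀"*): there is `δ₂ > 0` and for every `0 ≤ α < 1` a constant `C_α ≥ 0` (on `d, L, a₀, a₁, α`) such that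
for every member `i`, direction `λ` and fine bonds `b₁, b₂` of the same direction with `|b₁₋ − b₂₋|_∞ ≤ Lʲ`:
`HasMajorant (tsGeo i R M) (y(·₋)) (P_{b₁,b₂}·onFun(G_□∘∇_λ*)) (C_α·(|b₁₋ − b₂₋|_∞/Lʲ)^α·e^{−δ₂|y − y′|_T})` — i.e.
`|(G_□∇_λ*μ)(b₁) − (G_□∇_λ*μ)(b₂)| ≤ C_α t^α e^{−δ₂|y(b₁₋) − y′|_T}|μ|` for `μ` supported in the block `y′`.
[cite: Balaban1984PropagatorsII, Prop. 2.5 p.246, (2.133) p.247, (2.137) p.247; Balaban1984PropagatorsI, (1.111), (1.109) p.35] -/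
theorem holderGDadj_member (d L : ℕ) (hd : 1 ≤ d + 1) (hL : Odd L ∧ 1 < L) {a₀ a₁ : ℝ} (ha₀ : 0 < a₀) (ha₁ : a₀ ≤ a₁) :
    ∃ δ : ℝ, 0 < δ ∧ ∀ α : ℝ, 0 ≤ α → α < 1 → ∃ C : ℝ, 0 ≤ C ∧ ∀ (i : TSIdx d L hd hL a₀ a₁) (R M : ℝ) (lam : Fin i.P.d)
      (b₁ b₂ : PBond i.P 0), b₁.dir = b₂.dir → supDist b₁.src b₂.src ≤ L ^ i.j →
      HasMajorant (g := tsGeo i R M) (fun b : PBond i.P 0 => iterBlockOf i.j b.src) (pairOp b₁ b₂ * onFun (i.D.G ∘ₗ i.Dla lam))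
        (fun y y' => C * (((supDist b₁.src b₂.src : ℕ) : ℝ) / (L : ℝ) ^ i.j) ^ α * Real.exp (-(δ * i.tdist y y'))) := by
  obtain ⟨δ, hδ, h⟩ := holderBound_GDadj_scaling d L hd hL ha₀ ha₁
  refine ⟨δ, hδ, fun α hα0 hα1 => ?_⟩
  obtain ⟨C, hC, hC'⟩ := h α hα0 hα1
  refine ⟨C, hC, fun i R M lam b₁ b₂ hdir hle => ?_⟩
  have ht : 0 ≤ C * (((supDist b₁.src b₂.src : ℕ) : ℝ) / (L : ℝ) ^ i.j) ^ α :=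
    mul_nonneg hC (Real.rpow_nonneg (by positivity) _)
  exact hasMajorant_pairOp_of_holderBound_classical i R M (i.D.G ∘ₗ i.Dla lam) b₁ b₂ ht fun y =>
    hC' i.m i.K i.j i.hc i.hj i.Λ' i.w i.hw0 i.hw1 lam b₁ b₂ hdir hle y

open Classical in
/-- the pair entries of `G_□∇_λ` are pair entries of `G_□∇_λ*` one input bond over:
`|(G∇_λ)(e_{b′})(b₁) − (G∇_λ)(e_{b′})(b₂)| = |(G∇_λ*)(e_{b′−e_λ})(b₁) − (G∇_λ*)(e_{b′−e_λ})(b₂)|` (p22's `Dl_single_eq`).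
[cite: Balaban1984PropagatorsI, (1.4) p.18, (1.111) p.35; bookkeeping ours] -/
theorem abs_GDl_pair_eq (i : TSIdx d L hd hL a₀ a₁) (lam : Fin i.P.d) (b' b₁ b₂ : PBond i.P 0) :
    |(i.D.G ∘ₗ i.Dl lam) ((@EuclideanSpace.single (PBond i.P 0) ℝ _ (fun a b => Classical.propDecidable (a = b)) b' (1 : ℝ))) b₁ -
        (i.D.G ∘ₗ i.Dl lam) ((@EuclideanSpace.single (PBond i.P 0) ℝ _ (fun a b => Classical.propDecidable (a = b)) b' (1 : ℝ))) b₂| =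
      |(i.D.G ∘ₗ i.Dla lam) ((@EuclideanSpace.single (PBond i.P 0) ℝ _ (fun a b => Classical.propDecidable (a = b)) ⟨b'.src.unshift lam, b'.dir⟩ (1 : ℝ))) b₁ -
        (i.D.G ∘ₗ i.Dla lam) ((@EuclideanSpace.single (PBond i.P 0) ℝ _ (fun a b => Classical.propDecidable (a = b)) ⟨b'.src.unshift lam, b'.dir⟩ (1 : ℝ))) b₂| := by
  rw [LinearMap.comp_apply, LinearMap.comp_apply, Dl_single_eq, map_neg, PiLp.neg_apply, PiLp.neg_apply, ← abs_neg]
  congr 1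
  ring

open Classical in
/-- **THE PAIR BLOCK BOUND OF `G_□∇_λ` FROM THAT OF `G_□∇_λ*`** — the INPUT-SHIFT bookkeeping of p22's `blockBound_GDl_scaling` for pair entries:
`(G∇_λ)(e_{b′}) = −(G∇_λ*)(e_{b′−e_λ})`, and the bonds `b′ − e_λ`, `b′₋ ∈ B(y)`, have their source in `B(y)` or in `B(y − e_λ)` (`iterBlockOf_shift_or`),
a block at unit distance `≤ 1` (`torusDist_blk_unshift_le_one`): a pair block bound `(C, δ)` of `G_□∇_λ*` gives `(C(1 + e^δ), δ)` for `G_□∇_λ`.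
[cite: Balaban1984PropagatorsII, (2.133) p.247, (2.137) p.247; Balaban1984PropagatorsI, (1.111) p.35; bookkeeping ours] -/
theorem holderBoundPair_GDl_of_GDadj (i : TSIdx d L hd hL a₀ a₁) (lam : Fin i.P.d) (b₁ b₂ : PBond i.P 0) {C δ : ℝ} (hC : 0 ≤ C) (hδ : 0 ≤ δ)
    (hGDla : ∀ y : Site i.P i.j, ∑ b' ∈ univ.filter (fun b' : PBond i.P 0 => iterBlockOf i.j b'.src = y),
      |(i.D.G ∘ₗ i.Dla lam) ((@EuclideanSpace.single (PBond i.P 0) ℝ _ (fun a b => Classical.propDecidable (a = b)) b' (1 : ℝ))) b₁ -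
        (i.D.G ∘ₗ i.Dla lam) ((@EuclideanSpace.single (PBond i.P 0) ℝ _ (fun a b => Classical.propDecidable (a = b)) b' (1 : ℝ))) b₂| ≤
        C * Real.exp (-(δ * i.tdist (iterBlockOf i.j b₁.src) y))) (y : Site i.P i.j) :
    ∑ b' ∈ univ.filter (fun b' : PBond i.P 0 => iterBlockOf i.j b'.src = y),
      |(i.D.G ∘ₗ i.Dl lam) ((@EuclideanSpace.single (PBond i.P 0) ℝ _ (fun a b => Classical.propDecidable (a = b)) b' (1 : ℝ))) b₁ -
        (i.D.G ∘ₗ i.Dl lam) ((@EuclideanSpace.single (PBond i.P 0) ℝ _ (fun a b => Classical.propDecidable (a = b)) b' (1 : ℝ))) b₂| ≤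
      C * (1 + Real.exp δ) * Real.exp (-(δ * i.tdist (iterBlockOf i.j b₁.src) y)) := by
  have hj' : i.j ≤ i.P.m + i.P.K := Nat.le_of_succ_le i.hj
  set f : PBond i.P 0 → ℝ := fun b'' =>
    |(i.D.G ∘ₗ i.Dla lam) ((@EuclideanSpace.single (PBond i.P 0) ℝ _ (fun a b => Classical.propDecidable (a = b)) b'' (1 : ℝ))) b₁ -
      (i.D.G ∘ₗ i.Dla lam) ((@EuclideanSpace.single (PBond i.P 0) ℝ _ (fun a b => Classical.propDecidable (a = b)) b'' (1 : ℝ))) b₂| with hf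
  have hf0 : ∀ b'', 0 ≤ f b'' := fun b'' => abs_nonneg _
  set u : PBond i.P 0 → PBond i.P 0 := fun b' => ⟨b'.src.unshift lam, b'.dir⟩ with hu
  have hu_inj : ∀ b₃ ∈ univ.filter (fun b' : PBond i.P 0 => iterBlockOf i.j b'.src = y),
      ∀ b₄ ∈ univ.filter (fun b' : PBond i.P 0 => iterBlockOf i.j b'.src = y), u b₃ = u b₄ → b₃ = b₄ := by
    intro b₃ _ b₄ _ h34
    have h34' : (⟨b₃.src.unshift lam, b₃.dir⟩ : PBond i.P 0) = ⟨b₄.src.unshift lam, b₄.dir⟩ := h34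
    obtain ⟨hs, hdir⟩ := PBond.mk.inj h34'
    have hs' : (b₃.src.unshift lam).shift lam = (b₄.src.unshift lam).shift lam := by rw [hs]
    rw [shift_unshift, shift_unshift] at hs'
    cases b₃; cases b₄
    simp only at hs' hdir
    rw [hs', hdir]
  -- reindex the sum by `u`
  have e1 : ∑ b' ∈ univ.filter (fun b' : PBond i.P 0 => iterBlockOf i.j b'.src = y),
      |(i.D.G ∘ₗ i.Dl lam) ((@EuclideanSpace.single (PBond i.P 0) ℝ _ (fun a b => Classical.propDecidable (a = b)) b' (1 : ℝ))) b₁ -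
        (i.D.G ∘ₗ i.Dl lam) ((@EuclideanSpace.single (PBond i.P 0) ℝ _ (fun a b => Classical.propDecidable (a = b)) b' (1 : ℝ))) b₂| =
      ∑ b'' ∈ (univ.filter (fun b' : PBond i.P 0 => iterBlockOf i.j b'.src = y)).image u, f b'' := by
    rw [Finset.sum_image hu_inj]
    exact Finset.sum_congr rfl fun b' _ => abs_GDl_pair_eq i lam b' b₁ b₂
  rw [e1]
  set I := (univ.filter (fun b' : PBond i.P 0 => iterBlockOf i.j b'.src = y)).image u with hI
  -- the members of `I`: their shifted source has block `y`
  have hmemI : ∀ b'' ∈ I, iterBlockOf i.j (b''.src.shift lam) = y := by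
    intro b'' hb''
    rw [hI, Finset.mem_image] at hb''
    obtain ⟨b', hb', rfl⟩ := hb''
    rw [Finset.mem_filter] at hb'
    show iterBlockOf i.j ((b'.src.unshift lam).shift lam) = y
    rw [shift_unshift]; exact hb'.2
  -- split `I` by the block of the source
  rw [← Finset.sum_filter_add_sum_filter_not I (fun b'' : PBond i.P 0 => iterBlockOf i.j b''.src = y) f]
  have hA : ∑ b'' ∈ I.filter (fun b'' : PBond i.P 0 => iterBlockOf i.j b''.src = y), f b'' ≤
      C * Real.exp (-(δ * i.tdist (iterBlockOf i.j b₁.src) y)) := by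
    refine le_trans (Finset.sum_le_sum_of_subset_of_nonneg ?_ fun b'' _ _ => hf0 b'') (hGDla y)
    intro b'' hb''
    rw [Finset.mem_filter] at hb'' ⊢
    exact ⟨Finset.mem_univ _, hb''.2⟩
  have hB : ∑ b'' ∈ I.filter (fun b'' : PBond i.P 0 => ¬ iterBlockOf i.j b''.src = y), f b'' ≤
      C * Real.exp δ * Real.exp (-(δ * i.tdist (iterBlockOf i.j b₁.src) y)) := by
    rcases (I.filter (fun b'' : PBond i.P 0 => ¬ iterBlockOf i.j b''.src = y)).eq_empty_or_nonempty with h0 | ⟨b₀, hb₀⟩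
    · rw [h0, Finset.sum_empty]; positivity
    · -- the off-block members all sit in the block `y − e_λ`, at unit distance `≤ 1` from `y`
      have hoff : ∀ b'' ∈ I.filter (fun b'' : PBond i.P 0 => ¬ iterBlockOf i.j b''.src = y),
          iterBlockOf i.j b''.src = y.unshift lam ∧
            torusSupNorm (Mk i.P i.j) (rep (Mk i.P i.j) (iterBlockOf i.j b''.src) - rep (Mk i.P i.j) y) ≤ 1 := by
        intro b'' hb''
        rw [Finset.mem_filter] at hb''
        have hy := hmemI b'' hb''.1
        rcases iterBlockOf_shift_or i.j hj' b''.src lam with h1 | h1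
        · exact absurd (h1.symm.trans hy) hb''.2
        · rw [hy] at h1
          have hdist := torusDist_blk_unshift_le_one hj' (b''.src.shift lam) lam
          rw [unshift_shift, hy] at hdist
          refine ⟨?_, hdist⟩
          rw [h1, unshift_shift]
      obtain ⟨hy₀, hd₀⟩ := hoff b₀ hb₀
      have hsub : I.filter (fun b'' : PBond i.P 0 => ¬ iterBlockOf i.j b''.src = y) ⊆
          univ.filter (fun b' : PBond i.P 0 => iterBlockOf i.j b'.src = y.unshift lam) := by
        intro b'' hb''
        rw [Finset.mem_filter]
        exact ⟨Finset.mem_univ _, (hoff b'' hb'').1⟩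
      refine le_trans (Finset.sum_le_sum_of_subset_of_nonneg hsub fun b'' _ _ => hf0 b'') ((hGDla (y.unshift lam)).trans ?_)
      rw [mul_assoc, ← Real.exp_add]
      refine mul_le_mul_of_nonneg_left (Real.exp_le_exp.2 ?_) hC
      -- triangle inequality: `|y(b₁) − y|_T ≤ |y(b₁) − (y − e_λ)|_T + 1`
      have htri := (torusDist_isPseudoDist (Mk i.P i.j)).triangle (iterBlockOf i.j b₁.src) (y.unshift lam) y
      rw [← hy₀] at htri ⊢
      unfold TSIdx.tdist
      have hm := mul_le_mul_of_nonneg_left (htri.trans (add_le_add le_rfl hd₀)) hδ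
      linarith
  calc ∑ b'' ∈ I.filter (fun b'' : PBond i.P 0 => iterBlockOf i.j b''.src = y), f b'' +
        ∑ b'' ∈ I.filter (fun b'' : PBond i.P 0 => ¬ iterBlockOf i.j b''.src = y), f b''
      ≤ C * Real.exp (-(δ * i.tdist (iterBlockOf i.j b₁.src) y)) + C * Real.exp δ * Real.exp (-(δ * i.tdist (iterBlockOf i.j b₁.src) y)) :=
        add_le_add hA hB
    _ = C * (1 + Real.exp δ) * Real.exp (-(δ * i.tdist (iterBlockOf i.j b₁.src) y)) := by ring

open Classical in
/-- **THE PAIR MAJORANT OF `G_□∘∇_λ` ON `T_□`** (input-shift twin of `holderGDadj_member`): there is `δ₂ > 0` and for every `0 ≤ α < 1` a `C_α ≥ 0` with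
`HasMajorant (tsGeo i R M) (y(·₋)) (P_{b₁,b₂}·onFun(G_□∘∇_λ)) (C_α·t^α·e^{−δ₂|y − y′|_T})` for bonds `b₁, b₂` of the same direction, `t = |b₁₋ − b₂₋|_∞/Lʲ ≤ 1`.
[cite: Balaban1984PropagatorsII, Prop. 2.5 p.246, (2.133) p.247, (2.141) p.247 (its column reading ours); Balaban1984PropagatorsI, (1.111) p.35] -/
theorem holderGDl_member (d L : ℕ) (hd : 1 ≤ d + 1) (hL : Odd L ∧ 1 < L) {a₀ a₁ : ℝ} (ha₀ : 0 < a₀) (ha₁ : a₀ ≤ a₁) :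
    ∃ δ : ℝ, 0 < δ ∧ ∀ α : ℝ, 0 ≤ α → α < 1 → ∃ C : ℝ, 0 ≤ C ∧ ∀ (i : TSIdx d L hd hL a₀ a₁) (R M : ℝ) (lam : Fin i.P.d)
      (b₁ b₂ : PBond i.P 0), b₁.dir = b₂.dir → supDist b₁.src b₂.src ≤ L ^ i.j →
      HasMajorant (g := tsGeo i R M) (fun b : PBond i.P 0 => iterBlockOf i.j b.src) (pairOp b₁ b₂ * onFun (i.D.G ∘ₗ i.Dl lam))
        (fun y y' => C * (((supDist b₁.src b₂.src : ℕ) : ℝ) / (L : ℝ) ^ i.j) ^ α * Real.exp (-(δ * i.tdist y y'))) := by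
  obtain ⟨δ, hδ, h⟩ := holderBound_GDadj_scaling d L hd hL ha₀ ha₁
  refine ⟨δ, hδ, fun α hα0 hα1 => ?_⟩
  obtain ⟨C, hC, hC'⟩ := h α hα0 hα1
  refine ⟨C * (1 + Real.exp δ), by positivity, fun i R M lam b₁ b₂ hdir hle => ?_⟩
  have hτ : 0 ≤ (((supDist b₁.src b₂.src : ℕ) : ℝ) / (L : ℝ) ^ i.j) ^ α := Real.rpow_nonneg (by positivity) _
  have ht : 0 ≤ C * (1 + Real.exp δ) * (((supDist b₁.src b₂.src : ℕ) : ℝ) / (L : ℝ) ^ i.j) ^ α := by positivity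
  refine hasMajorant_pairOp_of_holderBound_classical i R M (i.D.G ∘ₗ i.Dl lam) b₁ b₂ ht fun y => ?_
  have hraw : ∀ y : Site i.P i.j, ∑ b' ∈ univ.filter (fun b' : PBond i.P 0 => iterBlockOf i.j b'.src = y),
      |(i.D.G ∘ₗ i.Dla lam) ((@EuclideanSpace.single (PBond i.P 0) ℝ _ (fun a b => Classical.propDecidable (a = b)) b' (1 : ℝ))) b₁ -
        (i.D.G ∘ₗ i.Dla lam) ((@EuclideanSpace.single (PBond i.P 0) ℝ _ (fun a b => Classical.propDecidable (a = b)) b' (1 : ℝ))) b₂| ≤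
        C * (((supDist b₁.src b₂.src : ℕ) : ℝ) / (L : ℝ) ^ i.j) ^ α * Real.exp (-(δ * i.tdist (iterBlockOf i.j b₁.src) y)) :=
    fun y => hC' i.m i.K i.j i.hc i.hj i.Λ' i.w i.hw0 i.hw1 lam b₁ b₂ hdir hle y
  have key := holderBoundPair_GDl_of_GDadj i lam b₁ b₂ (mul_nonneg hC hτ) hδ.le hraw y
  refine key.trans (le_of_eq ?_)
  ring

/-- monotonicity of the weighted exponential majorant in the constant and the rate. [folklore] -/
private theorem expMajorantW_mono {A A' τ δ δ' t : ℝ} (hA : A ≤ A') (hA' : 0 ≤ A') (hτ : 0 ≤ τ) (hδ : δ' ≤ δ) (ht : 0 ≤ t) :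
    A * τ * Real.exp (-(δ * t)) ≤ A' * τ * Real.exp (-(δ' * t)) :=
  (mul_le_mul_of_nonneg_right (mul_le_mul_of_nonneg_right hA hτ) (Real.exp_nonneg _)).trans
    (mul_le_mul_of_nonneg_left (Real.exp_le_exp.mpr (neg_le_neg (mul_le_mul_of_nonneg_right hδ ht))) (mul_nonneg hA' hτ))

open Classical in
/-- **THE PAIR MAJORANTS OF BOTH RIGHT LEGS `G_□∘∇_λ`, `G_□∘∇_λ*` WITH ONE `(δ; α ↦ C_α)`** (`holderGDl_member`, `holderGDadj_member`; the pair twin of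
p22's `ineq2133_legs_right`). [cite: Balaban1984PropagatorsII, Prop. 2.5 p.246, (2.133), (2.137), (2.141) p.247; Balaban1984PropagatorsI, (1.111) p.35] -/
theorem holderGE_member (d L : ℕ) (hd : 1 ≤ d + 1) (hL : Odd L ∧ 1 < L) {a₀ a₁ : ℝ} (ha₀ : 0 < a₀) (ha₁ : a₀ ≤ a₁) :
    ∃ δ : ℝ, 0 < δ ∧ ∀ α : ℝ, 0 ≤ α → α < 1 → ∃ C : ℝ, 0 ≤ C ∧ ∀ (t : TSIdx d L hd hL a₀ a₁) (R M : ℝ) (e : Fin t.P.d × Bool)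
      (b₁ b₂ : PBond t.P 0), b₁.dir = b₂.dir → supDist b₁.src b₂.src ≤ L ^ t.j →
      HasMajorant (g := tsGeo t R M) (fun b : PBond t.P 0 => iterBlockOf t.j b.src)
        (pairOp b₁ b₂ * onFun (t.D.G ∘ₗ (if e.2 then t.Dl e.1 else t.Dla e.1)))
        (fun y y' => C * (((supDist b₁.src b₂.src : ℕ) : ℝ) / (L : ℝ) ^ t.j) ^ α * Real.exp (-(δ * t.tdist y y'))) := by
  obtain ⟨δ₁, hδ₁, h₁⟩ := holderGDl_member d L hd hL ha₀ ha₁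
  obtain ⟨δ₂, hδ₂, h₂⟩ := holderGDadj_member d L hd hL ha₀ ha₁
  refine ⟨min δ₁ δ₂, lt_min hδ₁ hδ₂, fun α hα0 hα1 => ?_⟩
  obtain ⟨A₁, hA₁, hm₁⟩ := h₁ α hα0 hα1
  obtain ⟨A₂, hA₂, hm₂⟩ := h₂ α hα0 hα1
  refine ⟨max A₁ A₂, le_max_of_le_left hA₁, fun t R M e b₁ b₂ hdir hle => ?_⟩
  have hτ : 0 ≤ (((supDist b₁.src b₂.src : ℕ) : ℝ) / (L : ℝ) ^ t.j) ^ α := Real.rpow_nonneg (by positivity) _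
  obtain ⟨lam, bb⟩ := e
  cases bb
  · exact hasMajorant_mono _ (hm₂ t R M lam b₁ b₂ hdir hle)
      (fun y y' => expMajorantW_mono (le_max_right _ _) (le_max_of_le_left hA₁) hτ (min_le_right _ _) (t.tdist_nonneg y y'))
  · exact hasMajorant_mono _ (hm₁ t R M lam b₁ b₂ hdir hle)
      (fun y y' => expMajorantW_mono (le_max_left _ _) (le_max_of_le_left hA₁) hτ (min_le_left _ _) (t.tdist_nonneg y y'))

end Member

/-! ## §2  The operator identities: the global pair difference of `G_□`, `G_□·E_e` is the conjugated scaled transplant of the member's -/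

section Identity

variable {d ℓ : ℕ} {hd : 1 ≤ d + 1} {hL : Odd (ℓ + 1) ∧ 1 < ℓ + 1} {a₀ a₁ : ℝ} {m K : ℕ} {Mh k R : ℕ} {P' : Fin (d + 1) → ℕ}
variable (hN : ∀ μ, N0 ℓ Mh k P' μ = (PV d ℓ m K hd hL).sitesPerDir 0) {D : TDomains d ℓ Mh k P' R} (hk : k ≤ m + K)
  (hMh1 : 1 ≤ Mh) (hP4 : ∀ μ, 4 ≤ P' μ) {a : ℕ} (hMha : Mh = (ℓ + 1) ^ a) (c : ↥(cubes D.toDomains)) (ha : a₀ ≤ a₁)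

/-- `P_{c₁+v,c₂+v}·G_□ = τ_{−v}·(s(□)⁻¹•ε(P_{ec₁,ec₂}·G_t)ρ)·τ_v` for window bonds `c₁, c₂` (p22's `Gl_eq` + transport calculus; = p22 g26's
`…B6CubeHolderInDecayV1.pairOp_translate_mul_Gl_eq`, not yet in the tree — inlined privately here).
[cite: Balaban1984PropagatorsII, (2.90)–(2.94) p.239, (2.133) p.247, p.238 (T_□ = □̃³); dictionary (charts), derivation p22's] -/
private theorem pairOp_translate_mul_Gl_eq' (hpl : Placed ℓ k P' c.1) (w : BondIdx (domT hN D hk) → ℝ) (cf : ℝ)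
    {c₁ c₂ : PBond (PV d ℓ m K hd hL) 0}
    (hc₁ : c₁ ∈ (cB (tC hN hk hMh1 hP4 c ha a (wC hN hk c w) cf) (x0 ℓ Mh k c.1) (hx0 hpl) (hfit hN hMh1 hP4 hMha c ha hpl)).W)
    (hc₂ : c₂ ∈ (cB (tC hN hk hMh1 hP4 c ha a (wC hN hk c w) cf) (x0 ℓ Mh k c.1) (hx0 hpl) (hfit hN hMh1 hP4 hMha c ha hpl)).W) :
    pairOp (c₁.translate (vch Mh k (svec ℓ k c.1.1 c.1.2))) (c₂.translate (vch Mh k (svec ℓ k c.1.1 c.1.2))) * Gl hN hk hMh1 hP4 hMha c ha hpl w cf =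
      TB (-vch Mh k (svec ℓ k c.1.1 c.1.2)) *
        ((sc hMh1 hP4 c cf)⁻¹ • transplant (cB (tC hN hk hMh1 hP4 c ha a (wC hN hk c w) cf) (x0 ℓ Mh k c.1) (hx0 hpl) (hfit hN hMh1 hP4 hMha c ha hpl)).W
          (eB (tC hN hk hMh1 hP4 c ha a (wC hN hk c w) cf) (x0 ℓ Mh k c.1))
          (pairOp (eB (tC hN hk hMh1 hP4 c ha a (wC hN hk c w) cf) (x0 ℓ Mh k c.1) c₁) (eB (tC hN hk hMh1 hP4 c ha a (wC hN hk c w) cf) (x0 ℓ Mh k c.1) c₂) *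
            onFun (tC hN hk hMh1 hP4 c ha a (wC hN hk c w) cf).D.G)) *
        TB (vch Mh k (svec ℓ k c.1.1 c.1.2)) := by
  rw [Gl_eq, ← TB_neg_mul_pairOp_mul_TB (vch Mh k (svec ℓ k c.1.1 c.1.2)) c₁ c₂, conj_mul, mul_smul_comm,
    transplant_pairOp_mul (W := (cB (tC hN hk hMh1 hP4 c ha a (wC hN hk c w) cf) (x0 ℓ Mh k c.1) (hx0 hpl) (hfit hN hMh1 hP4 hMha c ha hpl)).W)
      (e := eB (tC hN hk hMh1 hP4 c ha a (wC hN hk c w) cf) (x0 ℓ Mh k c.1))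
      (cB (tC hN hk hMh1 hP4 c ha a (wC hN hk c w) cf) (x0 ℓ Mh k c.1) (hx0 hpl) (hfit hN hMh1 hP4 hMha c ha hpl)).inj _ hc₁ hc₂]

/-- **`P_{c₁+v,c₂+v}·(G_□·E_e) = τ_{−v}·(s(□)⁻¹•ε(P_{ec₁,ec₂}·(G_t∘∇_e))ρ)·τ_v`** for window bonds `c₁, c₂` of the chart frame (`v` the chart vector,
`∇_e = ∇_λ` or `∇_λ*`): p22's `Gl_mul_EC_eq`, the translation of the pair operator and its passage through the (injective) window transplant — the
global pair difference of the right leg `G_□·E_e` IS the transplant of the member's.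
[cite: Balaban1984PropagatorsII, (2.133) p.247, (2.141) p.247, (2.92) p.239 (line 1), p.238 (T_□ = □̃³); dictionary (charts), derivation ours] -/
theorem pairOp_translate_mul_Gl_mul_EC_eq (hpl : Placed ℓ k P' c.1) (w : BondIdx (domT hN D hk) → ℝ) (cf : ℝ) (e : Fin (d + 1) × Bool)
    {c₁ c₂ : PBond (PV d ℓ m K hd hL) 0}
    (hc₁ : c₁ ∈ (cB (tC hN hk hMh1 hP4 c ha a (wC hN hk c w) cf) (x0 ℓ Mh k c.1) (hx0 hpl) (hfit hN hMh1 hP4 hMha c ha hpl)).W)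
    (hc₂ : c₂ ∈ (cB (tC hN hk hMh1 hP4 c ha a (wC hN hk c w) cf) (x0 ℓ Mh k c.1) (hx0 hpl) (hfit hN hMh1 hP4 hMha c ha hpl)).W) :
    pairOp (c₁.translate (vch Mh k (svec ℓ k c.1.1 c.1.2))) (c₂.translate (vch Mh k (svec ℓ k c.1.1 c.1.2))) *
        (Gl hN hk hMh1 hP4 hMha c ha hpl w cf * EC hN hk hMh1 hP4 hMha c ha hpl w cf e) =
      TB (-vch Mh k (svec ℓ k c.1.1 c.1.2)) *
        ((sc hMh1 hP4 c cf)⁻¹ • transplant (cB (tC hN hk hMh1 hP4 c ha a (wC hN hk c w) cf) (x0 ℓ Mh k c.1) (hx0 hpl) (hfit hN hMh1 hP4 hMha c ha hpl)).W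
          (eB (tC hN hk hMh1 hP4 c ha a (wC hN hk c w) cf) (x0 ℓ Mh k c.1))
          (pairOp (eB (tC hN hk hMh1 hP4 c ha a (wC hN hk c w) cf) (x0 ℓ Mh k c.1) c₁) (eB (tC hN hk hMh1 hP4 c ha a (wC hN hk c w) cf) (x0 ℓ Mh k c.1) c₂) *
            onFun ((tC hN hk hMh1 hP4 c ha a (wC hN hk c w) cf).D.G ∘ₗ
              (if e.2 then (tC hN hk hMh1 hP4 c ha a (wC hN hk c w) cf).Dl e.1 else (tC hN hk hMh1 hP4 c ha a (wC hN hk c w) cf).Dla e.1)))) *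
        TB (vch Mh k (svec ℓ k c.1.1 c.1.2)) := by
  rw [Gl_mul_EC_eq, ← TB_neg_mul_pairOp_mul_TB (vch Mh k (svec ℓ k c.1.1 c.1.2)) c₁ c₂, conj_mul, mul_smul_comm,
    transplant_pairOp_mul (W := (cB (tC hN hk hMh1 hP4 c ha a (wC hN hk c w) cf) (x0 ℓ Mh k c.1) (hx0 hpl) (hfit hN hMh1 hP4 hMha c ha hpl)).W)
      (e := eB (tC hN hk hMh1 hP4 c ha a (wC hN hk c w) cf) (x0 ℓ Mh k c.1))
      (cB (tC hN hk hMh1 hP4 c ha a (wC hN hk c w) cf) (x0 ℓ Mh k c.1) (hx0 hpl) (hfit hN hMh1 hP4 hMha c ha hpl)).inj _ hc₁ hc₂]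

end Identity

/-! ## §3  On the global torus: the legs OUTPUT-localised over `□⁺ = Q^T_□`, inputs anywhere -/

section Cube

/-- **`hGEout` FOR THE CUBE: THE RIGHT LEGS `G_□·E_e` HAVE AN OUTPUT-LOCALISED MAJORANT OVER `Q^T_□` WITH GLOBAL DECAY AND PRINT'S PREFACTOR** (`L ≥ 5`):
`OutMajorant (geomT D) (blkV1 hN D) (G_□·E_e) (Q^T_□) (C_G·(L^{j(y)}/c′)²·e^{−δ_G d_T(y,y′)})`, one `(δ_G, C_G)` for all cubes and all `2(d+1)` legs —
outputs over the central reach, inputs ANYWHERE; the Out twin of p22's `hGEin_cube` (same member input `ineq2133_legs_right`, same identity `Gl_mul_EC_eq`,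
r03's `outDecay_window_V1` for `inDecay_window_V1`). [cite: Balaban1984PropagatorsII, (2.133) p.247, (2.141) p.247 (its column reading ours), (2.92) p.239
(line 1), (2.134) p.247] -/
theorem hGEout_cube (d ℓ : ℕ) (hd : 1 ≤ d + 1) (hL : Odd (ℓ + 1) ∧ 1 < ℓ + 1) {a₀ a₁ : ℝ} (ha₀ : 0 < a₀) (ha₁ : a₀ ≤ a₁) :
    ∃ δG : ℝ, 0 < δG ∧ ∃ CG : ℝ, 0 ≤ CG ∧ ∀ (m K : ℕ) {Mh k R : ℕ} {P' : Fin (d + 1) → ℕ}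
      (hN : ∀ μ, N0 ℓ Mh k P' μ = (PV d ℓ m K hd hL).sitesPerDir 0) (D : TDomains d ℓ Mh k P' R) (hk : k ≤ m + K)
      (hMh1 : 1 ≤ Mh) (hP4 : ∀ μ, 4 ≤ P' μ) {a : ℕ} (hMha : Mh = (ℓ + 1) ^ a) (_ : 2 ≤ Mh) (_ : 2 * (ℓ + 1) ^ 2 ≤ R) (_ : 4 ≤ ℓ)
      (c : ↥(cubes D.toDomains)) (hpl : Placed ℓ k P' c.1) (w : BondIdx (domT hN D hk) → ℝ) (cf : ℝ) (e : Fin (d + 1) × Bool),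
      OutMajorant (g := geomT D) (blkV1 hN D) (Gl hN hk hMh1 hP4 hMha c ha₁ hpl w cf * EC hN hk hMh1 hP4 hMha c ha₁ hpl w cf e) (ST D hMh1 hP4 c)
        (fun y y' => CG * pref cf y * Real.exp (-(δG * (geomT D).dist y y'))) := by
  obtain ⟨δ, hδ, A, hA, hmem⟩ := ineq2133_legs_right d (ℓ + 1) hd hL ha₀ ha₁
  refine ⟨δ / (((d : ℝ) + 1) * ((9 : ℕ) : ℝ)), by positivity,
    (((ℓ + 1) ^ (d + 1) : ℕ) : ℝ) * (A * Real.exp (δ * (((d : ℝ) + 1) + ((d : ℝ) + 1)) / (((d : ℝ) + 1) * ((9 : ℕ) : ℝ)))), by positivity, ?_⟩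
  intro m K Mh k R P' hN D hk hMh1 hP4 a hMha hMh hR2 hℓ c hpl w cf e
  have hP : ∀ μ, 1 ≤ P' μ := one_le_of_four_le hP4
  have h1 := outDecay_window_V1 (t := tC hN hk hMh1 hP4 c ha₁ a (wC hN hk c w) cf) (x₀ := x0 ℓ Mh k c.1) (hx₀ := hx0 hpl)
    (hfit := hfit hN hMh1 hP4 hMha c ha₁ hpl) hN (D.chart (svec ℓ k c.1.1 c.1.2)) hA hδ.le (hmem _ e) hMh1 hP
    (hdiv_cube hN hk hMh1 hP4 c ha₁ (wC hN hk c w) cf) (hlev_full hN hk hMh1 hP4 hMha c ha₁ hR2 (wC hN hk c w) cf) (C := 9) (by norm_num)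
    (SQ hMh1 hP4 c) (fun b _ hbS => hband_cube hN hk hMh1 hP4 hMha c ha₁ hℓ hMh hR2 (wC hN hk c w) cf b hbS)
  have h2 := outMajorant_smul_of_le_on (blkV1 hN (D.chart (svec ℓ k c.1.1 c.1.2))) h1 _
    (transplant_off hN hk hMh1 hP4 hMha c ha₁ hpl (wC hN hk c w) cf _) (inv_nonneg.2 (sc_nonneg hMh1 hP4 c cf))
    (K' := fun y y' => (((ℓ + 1) ^ (d + 1) : ℕ) : ℝ) * (A * Real.exp (δ * (((d : ℝ) + 1) + ((d : ℝ) + 1)) / (((d : ℝ) + 1) * ((9 : ℕ) : ℝ)))) *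
      pref cf y * Real.exp (-(δ / (((d : ℝ) + 1) * ((9 : ℕ) : ℝ)) * (geomT (D.chart (svec ℓ k c.1.1 c.1.2))).dist y y')))
    (fun a b => by have := pref_nonneg cf a; positivity)
    (fun b hb _ y => smul_kernel_le (sc_inv_le_pref hN hk hMh1 hP4 hMha c ha₁ hR2 hpl (wC hN hk c w) cf hb) (by positivity) (by positivity)
      (Real.exp_nonneg _))
  have h3 := outMajorant_conj_chart hN D hMh1 hP (svec ℓ k c.1.1 c.1.2) h2
    (K' := fun y y' => (((ℓ + 1) ^ (d + 1) : ℕ) : ℝ) * (A * Real.exp (δ * (((d : ℝ) + 1) + ((d : ℝ) + 1)) / (((d : ℝ) + 1) * ((9 : ℕ) : ℝ)))) *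
      pref cf y * Real.exp (-(δ / (((d : ℝ) + 1) * ((9 : ℕ) : ℝ)) * (geomT D).dist y y')))
    (fun a b => le_of_eq (kernel_blkMap D hMh1 hP (svec ℓ k c.1.1 c.1.2) (fun n => ((((ℓ + 1 : ℕ) : ℝ)) ^ n / cf) ^ 2) _ _ a b))
  rw [Gl_mul_EC_eq]
  exact outMajorant_congr_set _ (mem_blkMap_image_SQ hMh1 hP4 c) h3

/-- **`hHGout` FOR THE CUBE: THE PAIR MAJORANT OF `G_□` ITSELF, OUTPUT-LOCALISED OVER `Q^T_□`, INPUTS ANYWHERE** (Lipschitz in the output): there are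
`δ_H > 0`, `C_H ≥ 0` (on `d, L, a₀, a₁`) such that on every admissible V1 torus (`L ≥ 5`, `M_h ≥ 2`, `R ≥ 2L²`), for every placed cube, weights, fine factor
and window bonds `c₁, c₂` of the same direction with charted initial points at sup-distance `≤ L^{j_t}` on `T_□`:
`OutMajorant (geomT D) (blkV1 hN D) (P_{c₁+v,c₂+v}·G_□) (Q^T_□) (C_H·t·(L^{j(y)}/c′)²·e^{−δ_H d_T(y,y′)})`, `t = |ec₁ − ec₂|_∞/L^{j_t}` (p22's `holderG_member`
through r03's OUTPUT band bridge; the Out twin of p22's `hHGin_cube`). [cite: Balaban1984PropagatorsII, (2.133) p.247, (2.137) p.247, Prop. 2.5 p.246,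
(2.90)–(2.94) p.239; Balaban1984PropagatorsI, (1.110) p.35] -/
theorem hHGout_cube (d ℓ : ℕ) (hd : 1 ≤ d + 1) (hL : Odd (ℓ + 1) ∧ 1 < ℓ + 1) {a₀ a₁ : ℝ} (ha₀ : 0 < a₀) (ha₁ : a₀ ≤ a₁) :
    ∃ δH : ℝ, 0 < δH ∧ ∃ CH : ℝ, 0 ≤ CH ∧ ∀ (m K : ℕ) {Mh k R : ℕ} {P' : Fin (d + 1) → ℕ}
      (hN : ∀ μ, N0 ℓ Mh k P' μ = (PV d ℓ m K hd hL).sitesPerDir 0) (D : TDomains d ℓ Mh k P' R) (hk : k ≤ m + K)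
      (hMh1 : 1 ≤ Mh) (hP4 : ∀ μ, 4 ≤ P' μ) {a : ℕ} (hMha : Mh = (ℓ + 1) ^ a) (_ : 2 ≤ Mh) (_ : 2 * (ℓ + 1) ^ 2 ≤ R) (_ : 4 ≤ ℓ)
      (c : ↥(cubes D.toDomains)) (hpl : Placed ℓ k P' c.1) (w : BondIdx (domT hN D hk) → ℝ) (cf : ℝ)
      (c₁ c₂ : PBond (PV d ℓ m K hd hL) 0)
      (_ : c₁ ∈ (cB (tC hN hk hMh1 hP4 c ha₁ a (wC hN hk c w) cf) (x0 ℓ Mh k c.1) (hx0 hpl) (hfit hN hMh1 hP4 hMha c ha₁ hpl)).W)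
      (_ : c₂ ∈ (cB (tC hN hk hMh1 hP4 c ha₁ a (wC hN hk c w) cf) (x0 ℓ Mh k c.1) (hx0 hpl) (hfit hN hMh1 hP4 hMha c ha₁ hpl)).W)
      (_ : c₁.dir = c₂.dir)
      (_ : supDist (eB (tC hN hk hMh1 hP4 c ha₁ a (wC hN hk c w) cf) (x0 ℓ Mh k c.1) c₁).src
        (eB (tC hN hk hMh1 hP4 c ha₁ a (wC hN hk c w) cf) (x0 ℓ Mh k c.1) c₂).src ≤ (ℓ + 1) ^ (tC hN hk hMh1 hP4 c ha₁ a (wC hN hk c w) cf).j),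
      OutMajorant (g := geomT D) (blkV1 hN D)
        (pairOp (c₁.translate (vch Mh k (svec ℓ k c.1.1 c.1.2))) (c₂.translate (vch Mh k (svec ℓ k c.1.1 c.1.2))) *
          Gl hN hk hMh1 hP4 hMha c ha₁ hpl w cf) (ST D hMh1 hP4 c)
        (fun y y' => CH * (((supDist (eB (tC hN hk hMh1 hP4 c ha₁ a (wC hN hk c w) cf) (x0 ℓ Mh k c.1) c₁).src
            (eB (tC hN hk hMh1 hP4 c ha₁ a (wC hN hk c w) cf) (x0 ℓ Mh k c.1) c₂).src : ℕ) : ℝ) /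
            (((ℓ + 1 : ℕ) : ℝ)) ^ (tC hN hk hMh1 hP4 c ha₁ a (wC hN hk c w) cf).j) * pref cf y * Real.exp (-(δH * (geomT D).dist y y'))) := by
  obtain ⟨δ, hδ, C, hC, hmem⟩ := holderG_member d (ℓ + 1) hd hL ha₀ ha₁
  refine ⟨δ / (((d : ℝ) + 1) * ((9 : ℕ) : ℝ)), by positivity,
    (((ℓ + 1) ^ (d + 1) : ℕ) : ℝ) * (C * Real.exp (δ * (((d : ℝ) + 1) + ((d : ℝ) + 1)) / (((d : ℝ) + 1) * ((9 : ℕ) : ℝ)))), by positivity, ?_⟩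
  intro m K Mh k R P' hN D hk hMh1 hP4 a hMha hMh hR2 hℓ c hpl w cf c₁ c₂ hc₁ hc₂ hdir hle
  have hP : ∀ μ, 1 ≤ P' μ := one_le_of_four_le hP4
  have hτ : 0 ≤ (((supDist (eB (tC hN hk hMh1 hP4 c ha₁ a (wC hN hk c w) cf) (x0 ℓ Mh k c.1) c₁).src
      (eB (tC hN hk hMh1 hP4 c ha₁ a (wC hN hk c w) cf) (x0 ℓ Mh k c.1) c₂).src : ℕ) : ℝ) /
      (((ℓ + 1 : ℕ) : ℝ)) ^ (tC hN hk hMh1 hP4 c ha₁ a (wC hN hk c w) cf).j) := by positivity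
  have hT' := hmem (tC hN hk hMh1 hP4 c ha₁ a (wC hN hk c w) cf) 0 0 (eB (tC hN hk hMh1 hP4 c ha₁ a (wC hN hk c w) cf) (x0 ℓ Mh k c.1) c₁)
    (eB (tC hN hk hMh1 hP4 c ha₁ a (wC hN hk c w) cf) (x0 ℓ Mh k c.1) c₂) hdir hle
  have h1 := outDecay_window_V1 (t := tC hN hk hMh1 hP4 c ha₁ a (wC hN hk c w) cf) (x₀ := x0 ℓ Mh k c.1) (hx₀ := hx0 hpl)
    (hfit := hfit hN hMh1 hP4 hMha c ha₁ hpl) hN (D.chart (svec ℓ k c.1.1 c.1.2)) (mul_nonneg hC hτ) hδ.le hT' hMh1 hP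
    (hdiv_cube hN hk hMh1 hP4 c ha₁ (wC hN hk c w) cf) (hlev_full hN hk hMh1 hP4 hMha c ha₁ hR2 (wC hN hk c w) cf) (C := 9) (by norm_num)
    (SQ hMh1 hP4 c) (fun b _ hbS => hband_cube hN hk hMh1 hP4 hMha c ha₁ hℓ hMh hR2 (wC hN hk c w) cf b hbS)
  have h2 := outMajorant_smul_of_le_on (blkV1 hN (D.chart (svec ℓ k c.1.1 c.1.2))) h1 _
    (transplant_off hN hk hMh1 hP4 hMha c ha₁ hpl (wC hN hk c w) cf _) (inv_nonneg.2 (sc_nonneg hMh1 hP4 c cf))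
    (K' := fun y y' => (((ℓ + 1) ^ (d + 1) : ℕ) : ℝ) * (C * (((supDist (eB (tC hN hk hMh1 hP4 c ha₁ a (wC hN hk c w) cf) (x0 ℓ Mh k c.1) c₁).src
        (eB (tC hN hk hMh1 hP4 c ha₁ a (wC hN hk c w) cf) (x0 ℓ Mh k c.1) c₂).src : ℕ) : ℝ) /
        (((ℓ + 1 : ℕ) : ℝ)) ^ (tC hN hk hMh1 hP4 c ha₁ a (wC hN hk c w) cf).j) *
        Real.exp (δ * (((d : ℝ) + 1) + ((d : ℝ) + 1)) / (((d : ℝ) + 1) * ((9 : ℕ) : ℝ)))) *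
      pref cf y * Real.exp (-(δ / (((d : ℝ) + 1) * ((9 : ℕ) : ℝ)) * (geomT (D.chart (svec ℓ k c.1.1 c.1.2))).dist y y')))
    (fun a b => by have := pref_nonneg cf a; positivity)
    (fun b hb _ y => smul_kernel_le (sc_inv_le_pref hN hk hMh1 hP4 hMha c ha₁ hR2 hpl (wC hN hk c w) cf hb) (by positivity) (by positivity)
      (Real.exp_nonneg _))
  have h3 := outMajorant_conj_chart hN D hMh1 hP (svec ℓ k c.1.1 c.1.2) h2
    (K' := fun y y' => (((ℓ + 1) ^ (d + 1) : ℕ) : ℝ) * (C * (((supDist (eB (tC hN hk hMh1 hP4 c ha₁ a (wC hN hk c w) cf) (x0 ℓ Mh k c.1) c₁).src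
        (eB (tC hN hk hMh1 hP4 c ha₁ a (wC hN hk c w) cf) (x0 ℓ Mh k c.1) c₂).src : ℕ) : ℝ) /
        (((ℓ + 1 : ℕ) : ℝ)) ^ (tC hN hk hMh1 hP4 c ha₁ a (wC hN hk c w) cf).j) *
        Real.exp (δ * (((d : ℝ) + 1) + ((d : ℝ) + 1)) / (((d : ℝ) + 1) * ((9 : ℕ) : ℝ)))) *
      pref cf y * Real.exp (-(δ / (((d : ℝ) + 1) * ((9 : ℕ) : ℝ)) * (geomT D).dist y y')))
    (fun a b => le_of_eq (kernel_blkMap D hMh1 hP (svec ℓ k c.1.1 c.1.2) (fun n => ((((ℓ + 1 : ℕ) : ℝ)) ^ n / cf) ^ 2) _ _ a b))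
  rw [pairOp_translate_mul_Gl_eq' hN hk hMh1 hP4 hMha c ha₁ hpl w cf hc₁ hc₂]
  refine outMajorant_mono _ (outMajorant_congr_set _ (mem_blkMap_image_SQ hMh1 hP4 c) h3) fun y _ y' => le_of_eq ?_
  ring

/-- **`hHGEout` FOR THE CUBE: THE PAIR MAJORANTS OF ALL `2(d+1)` RIGHT LEGS `G_□·E_e`, OUTPUT-LOCALISED OVER `Q^T_□`, INPUTS ANYWHERE** — the cube-level
form of [4] (1.111)₂ `‖ζG∇*J‖_α` (and of its input-shift twin for `∇_λ`): there is `δ_H > 0` and for every `0 ≤ α < 1` a constant `C_H ≥ 0` (on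
`d, L, a₀, a₁, α`) such that on every admissible V1 torus, for every placed cube, weights, fine factor, leg `e` and window bonds `c₁, c₂` of the same
direction with charted initial points at sup-distance `≤ L^{j_t}` on `T_□`:
`OutMajorant (geomT D) (blkV1 hN D) (P_{c₁+v,c₂+v}·(G_□·E_e)) (Q^T_□) (C_H·t^α·(L^{j(y)}/c′)²·e^{−δ_H d_T(y,y′)})`, `t = |ec₁ − ec₂|_∞/L^{j_t}`.
[cite: Balaban1984PropagatorsII, (2.137) p.247 («‖ζG∇*J‖_α»), (2.133), (2.141) p.247, Prop. 2.5 p.246, (2.92) p.239 (line 1); Balaban1984PropagatorsI,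
(1.111) p.35] -/
theorem hHGEout_cube (d ℓ : ℕ) (hd : 1 ≤ d + 1) (hL : Odd (ℓ + 1) ∧ 1 < ℓ + 1) {a₀ a₁ : ℝ} (ha₀ : 0 < a₀) (ha₁ : a₀ ≤ a₁) :
    ∃ δH : ℝ, 0 < δH ∧ ∀ α : ℝ, 0 ≤ α → α < 1 → ∃ CH : ℝ, 0 ≤ CH ∧ ∀ (m K : ℕ) {Mh k R : ℕ} {P' : Fin (d + 1) → ℕ}
      (hN : ∀ μ, N0 ℓ Mh k P' μ = (PV d ℓ m K hd hL).sitesPerDir 0) (D : TDomains d ℓ Mh k P' R) (hk : k ≤ m + K)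
      (hMh1 : 1 ≤ Mh) (hP4 : ∀ μ, 4 ≤ P' μ) {a : ℕ} (hMha : Mh = (ℓ + 1) ^ a) (_ : 2 ≤ Mh) (_ : 2 * (ℓ + 1) ^ 2 ≤ R) (_ : 4 ≤ ℓ)
      (c : ↥(cubes D.toDomains)) (hpl : Placed ℓ k P' c.1) (w : BondIdx (domT hN D hk) → ℝ) (cf : ℝ) (e : Fin (d + 1) × Bool)
      (c₁ c₂ : PBond (PV d ℓ m K hd hL) 0)
      (_ : c₁ ∈ (cB (tC hN hk hMh1 hP4 c ha₁ a (wC hN hk c w) cf) (x0 ℓ Mh k c.1) (hx0 hpl) (hfit hN hMh1 hP4 hMha c ha₁ hpl)).W)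
      (_ : c₂ ∈ (cB (tC hN hk hMh1 hP4 c ha₁ a (wC hN hk c w) cf) (x0 ℓ Mh k c.1) (hx0 hpl) (hfit hN hMh1 hP4 hMha c ha₁ hpl)).W)
      (_ : c₁.dir = c₂.dir)
      (_ : supDist (eB (tC hN hk hMh1 hP4 c ha₁ a (wC hN hk c w) cf) (x0 ℓ Mh k c.1) c₁).src
        (eB (tC hN hk hMh1 hP4 c ha₁ a (wC hN hk c w) cf) (x0 ℓ Mh k c.1) c₂).src ≤ (ℓ + 1) ^ (tC hN hk hMh1 hP4 c ha₁ a (wC hN hk c w) cf).j),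
      OutMajorant (g := geomT D) (blkV1 hN D)
        (pairOp (c₁.translate (vch Mh k (svec ℓ k c.1.1 c.1.2))) (c₂.translate (vch Mh k (svec ℓ k c.1.1 c.1.2))) *
          (Gl hN hk hMh1 hP4 hMha c ha₁ hpl w cf * EC hN hk hMh1 hP4 hMha c ha₁ hpl w cf e)) (ST D hMh1 hP4 c)
        (fun y y' => CH * ((((supDist (eB (tC hN hk hMh1 hP4 c ha₁ a (wC hN hk c w) cf) (x0 ℓ Mh k c.1) c₁).src
            (eB (tC hN hk hMh1 hP4 c ha₁ a (wC hN hk c w) cf) (x0 ℓ Mh k c.1) c₂).src : ℕ) : ℝ) /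
            (((ℓ + 1 : ℕ) : ℝ)) ^ (tC hN hk hMh1 hP4 c ha₁ a (wC hN hk c w) cf).j) ^ α) * pref cf y * Real.exp (-(δH * (geomT D).dist y y'))) := by
  obtain ⟨δ, hδ, hmemα⟩ := holderGE_member d (ℓ + 1) hd hL ha₀ ha₁
  refine ⟨δ / (((d : ℝ) + 1) * ((9 : ℕ) : ℝ)), by positivity, fun α hα0 hα1 => ?_⟩
  obtain ⟨C, hC, hmem⟩ := hmemα α hα0 hα1
  refine ⟨(((ℓ + 1) ^ (d + 1) : ℕ) : ℝ) * (C * Real.exp (δ * (((d : ℝ) + 1) + ((d : ℝ) + 1)) / (((d : ℝ) + 1) * ((9 : ℕ) : ℝ)))), by positivity, ?_⟩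
  intro m K Mh k R P' hN D hk hMh1 hP4 a hMha hMh hR2 hℓ c hpl w cf e c₁ c₂ hc₁ hc₂ hdir hle
  have hP : ∀ μ, 1 ≤ P' μ := one_le_of_four_le hP4
  have hτ : 0 ≤ ((((supDist (eB (tC hN hk hMh1 hP4 c ha₁ a (wC hN hk c w) cf) (x0 ℓ Mh k c.1) c₁).src
      (eB (tC hN hk hMh1 hP4 c ha₁ a (wC hN hk c w) cf) (x0 ℓ Mh k c.1) c₂).src : ℕ) : ℝ) /
      (((ℓ + 1 : ℕ) : ℝ)) ^ (tC hN hk hMh1 hP4 c ha₁ a (wC hN hk c w) cf).j) ^ α) := Real.rpow_nonneg (by positivity) _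
  have hT' := hmem (tC hN hk hMh1 hP4 c ha₁ a (wC hN hk c w) cf) 0 0 e (eB (tC hN hk hMh1 hP4 c ha₁ a (wC hN hk c w) cf) (x0 ℓ Mh k c.1) c₁)
    (eB (tC hN hk hMh1 hP4 c ha₁ a (wC hN hk c w) cf) (x0 ℓ Mh k c.1) c₂) hdir hle
  have h1 := outDecay_window_V1 (t := tC hN hk hMh1 hP4 c ha₁ a (wC hN hk c w) cf) (x₀ := x0 ℓ Mh k c.1) (hx₀ := hx0 hpl)
    (hfit := hfit hN hMh1 hP4 hMha c ha₁ hpl) hN (D.chart (svec ℓ k c.1.1 c.1.2)) (mul_nonneg hC hτ) hδ.le hT' hMh1 hP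
    (hdiv_cube hN hk hMh1 hP4 c ha₁ (wC hN hk c w) cf) (hlev_full hN hk hMh1 hP4 hMha c ha₁ hR2 (wC hN hk c w) cf) (C := 9) (by norm_num)
    (SQ hMh1 hP4 c) (fun b _ hbS => hband_cube hN hk hMh1 hP4 hMha c ha₁ hℓ hMh hR2 (wC hN hk c w) cf b hbS)
  have h2 := outMajorant_smul_of_le_on (blkV1 hN (D.chart (svec ℓ k c.1.1 c.1.2))) h1 _
    (transplant_off hN hk hMh1 hP4 hMha c ha₁ hpl (wC hN hk c w) cf _) (inv_nonneg.2 (sc_nonneg hMh1 hP4 c cf))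
    (K' := fun y y' => (((ℓ + 1) ^ (d + 1) : ℕ) : ℝ) * (C * ((((supDist (eB (tC hN hk hMh1 hP4 c ha₁ a (wC hN hk c w) cf) (x0 ℓ Mh k c.1) c₁).src
        (eB (tC hN hk hMh1 hP4 c ha₁ a (wC hN hk c w) cf) (x0 ℓ Mh k c.1) c₂).src : ℕ) : ℝ) /
        (((ℓ + 1 : ℕ) : ℝ)) ^ (tC hN hk hMh1 hP4 c ha₁ a (wC hN hk c w) cf).j) ^ α) *
        Real.exp (δ * (((d : ℝ) + 1) + ((d : ℝ) + 1)) / (((d : ℝ) + 1) * ((9 : ℕ) : ℝ)))) *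
      pref cf y * Real.exp (-(δ / (((d : ℝ) + 1) * ((9 : ℕ) : ℝ)) * (geomT (D.chart (svec ℓ k c.1.1 c.1.2))).dist y y')))
    (fun a b => by have := pref_nonneg cf a; positivity)
    (fun b hb _ y => smul_kernel_le (sc_inv_le_pref hN hk hMh1 hP4 hMha c ha₁ hR2 hpl (wC hN hk c w) cf hb) (by positivity) (by positivity)
      (Real.exp_nonneg _))
  have h3 := outMajorant_conj_chart hN D hMh1 hP (svec ℓ k c.1.1 c.1.2) h2
    (K' := fun y y' => (((ℓ + 1) ^ (d + 1) : ℕ) : ℝ) * (C * ((((supDist (eB (tC hN hk hMh1 hP4 c ha₁ a (wC hN hk c w) cf) (x0 ℓ Mh k c.1) c₁).src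
        (eB (tC hN hk hMh1 hP4 c ha₁ a (wC hN hk c w) cf) (x0 ℓ Mh k c.1) c₂).src : ℕ) : ℝ) /
        (((ℓ + 1 : ℕ) : ℝ)) ^ (tC hN hk hMh1 hP4 c ha₁ a (wC hN hk c w) cf).j) ^ α) *
        Real.exp (δ * (((d : ℝ) + 1) + ((d : ℝ) + 1)) / (((d : ℝ) + 1) * ((9 : ℕ) : ℝ)))) *
      pref cf y * Real.exp (-(δ / (((d : ℝ) + 1) * ((9 : ℕ) : ℝ)) * (geomT D).dist y y')))
    (fun a b => le_of_eq (kernel_blkMap D hMh1 hP (svec ℓ k c.1.1 c.1.2) (fun n => ((((ℓ + 1 : ℕ) : ℝ)) ^ n / cf) ^ 2) _ _ a b))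
  rw [pairOp_translate_mul_Gl_mul_EC_eq hN hk hMh1 hP4 hMha c ha₁ hpl w cf e hc₁ hc₂]
  refine outMajorant_mono _ (outMajorant_congr_set _ (mem_blkMap_image_SQ hMh1 hP4 c) h3) fun y _ y' => le_of_eq ?_
  ring

end Cube

end Literature.MathematicalPhysics.QuantumFieldTheory.Balaban1983to89.B6CubePairOutDecayV1

end
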